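import Summits.PneNP.PneNP.Theses.SymmetryBudget
import Summits.PneNP.PneNP.Theorems.WindowHam.Negative.InvariantDNFSymmetry
import Literature.Combinatorics.SimpleGraph.HamiltonianCycleListings

/-!
# `HAM_m` has a symmetric circuit at every `m` and every budget; "eventually" = "everywhere";
# `HamCompiles` is `NP ⊆ P → ¬ WindowHam` (crux `stmt-PneNP-2143`, negative-side support)

Consequences of the symmetric DNF (`InvariantDNF.lean`) for the cruxes of route `SymmetryBudget`:
* `hasSymCircuit_hamFn` — Hamiltonicity of the decoded graph has a `Γ`-symmetric threshold circuit
  with `m² + 2^{m²} + 1` gates for every `m` and every `Γ` (the predicate negated inside `WindowHam`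
  is inhabited: the crux is purely quantitative); `symCircuitSizeOver_hamFn_le`;
* `hasSym_ham_eventually_iff_forall` — patching small `m` with the DNF, symmetric poly-size circuits
  for HAM from some threshold on (one polynomial) exist iff they exist at every `m`;
* `not_windowHam_iff_forall` — hence `¬ WindowHam` is verbatim the CONCLUSION of the sibling crux
  `HamCompiles`, and `hamCompiles_iff_collapse_imp_not_windowHam : HamCompiles ↔ (NP ⊆ P → ¬ WindowHam)`:
  the route's deciding theorem is the tautology `W → (C → ¬W) → ¬C`, and an unconditional disproof of
  `WindowHam` would prove `HamCompiles` outright.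
-/

namespace Summit.PneNP.PneNP.Theorems.WindowHam.Negative

open Literature.Computability.Complexity

/-! ### Matrix inputs: every invariant function has a symmetric circuit -/

/-- **Every `Γ`-invariant function of an `m × m` Boolean matrix is computed by a `Γ`-symmetric
`tcBasis`-circuit with `m² + 2^{m²} + 1` gates** (its DNF). So `HasSymCircuit` / the route's `HasSym`
is never vacuous for invariant functions, and symmetric circuit complexity is at most exponential.
[folklore] -/
theorem hasSymCircuit_of_invariant {m : ℕ} (Γ : Set (Equiv.Perm (Fin m)))
    (f : (Fin m × Fin m → Bool) → Bool)
    (hf : ∀ ρ ∈ Γ, ∀ x : Fin m × Fin m → Bool, f (fun q => x (ρ q.1, ρ q.2)) = f x) :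
    HasSymCircuit tcBasis Γ (m * m + 2 ^ (m * m) + 1) f := by
  refine ⟨dnfCircuit f, dnfCircuit_isOver_tcBasis f, ?_, ?_, dnfCircuit_computes f⟩
  · rw [dnfCircuit_size, Fintype.card_fun, Fintype.card_bool, Fintype.card_prod, Fintype.card_fin]
  · rw [Circuit.isSymmetricUnder_iff_isVarSymmetric_image]
    refine dnfCircuit_isVarSymmetric ?_
    rintro π ⟨ρ, hρ, rfl⟩ x
    exact hf ρ hρ x


open scoped Classical in
/-- Hamiltonicity of the decoded graph is invariant under relabelling the vertices. [folklore] -/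
theorem ham_invariant {m : ℕ} (ρ : Equiv.Perm (Fin m)) (x : Fin m × Fin m → Bool) :
    decide (SimpleGraph.fromRel fun u v => (fun q : Fin m × Fin m => x (ρ q.1, ρ q.2)) (u, v) = true).IsHamiltonian
      = decide (SimpleGraph.fromRel fun u v => x (u, v) = true).IsHamiltonian := by
  rw [decide_eq_decide]
  refine Literature.Combinatorics.SimpleGraph.isHamiltonian_iff_of_iso ⟨ρ, ?_⟩
  intro a b
  simp only [SimpleGraph.fromRel_adj, ne_eq, EmbeddingLike.apply_eq_iff_eq]

open scoped Classical in
/-- **`HAM_m` has a `Bud(m,g)`-symmetric (indeed `Γ`-symmetric for every `Γ`) threshold circuit with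
`m² + 2^{m²} + 1` gates, at every `m`**: the predicate negated inside `WindowHam` is inhabited at
exponential size, so the crux is purely quantitative (no vacuity either way). [folklore] -/
theorem hasSymCircuit_hamFn {m : ℕ} (Γ : Set (Equiv.Perm (Fin m))) :
    HasSymCircuit tcBasis Γ (m * m + 2 ^ (m * m) + 1)
      (fun x : Fin m × Fin m → Bool =>
        decide (SimpleGraph.fromRel fun u v => x (u, v) = true).IsHamiltonian) :=
  hasSymCircuit_of_invariant Γ _ fun ρ _ x => ham_invariant ρ x

open scoped Classical in
/-- Hence the symmetric circuit complexity of `HAM_m` is attained and at most `m² + 2^{m²} + 1`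
under every set of permutations. [folklore] -/
theorem symCircuitSizeOver_hamFn_le {m : ℕ} (Γ : Set (Equiv.Perm (Fin m))) :
    symCircuitSizeOver tcBasis Γ
        (fun x : Fin m × Fin m → Bool =>
          decide (SimpleGraph.fromRel fun u v => x (u, v) = true).IsHamiltonian)
      ≤ m * m + 2 ^ (m * m) + 1 := by
  obtain ⟨C, hB, hs, hΓ, hf⟩ := hasSymCircuit_hamFn (m := m) Γ
  exact (symCircuitSizeOver_le_of_computes C hB hΓ hf).trans hs

/-! ### Consequences for the cruxes: "eventually" = "everywhere", and `HamCompiles` unmasked -/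

open Filter
open Summit.PneNP.PneNP.Theses.SymmetryBudget (WindowHam HamCompiles)

open scoped Classical in
/-- **Patching small `m`.** For Hamiltonicity, symmetric poly-size circuits from some threshold on
(one polynomial) exist iff they exist at EVERY `m` (one polynomial): below the threshold use the
DNF (`hasSymCircuit_hamFn`) and add the finitely many exponential sizes to the constant term. Holds
for every budget function `g`. [folklore] -/
theorem hasSym_ham_eventually_iff_forall (g : ℕ → ℕ) :
    (∃ p : Polynomial ℕ, ∃ N : ℕ, ∀ m ≥ N,
        HasSymCircuit tcBasis (pointStabiliserBudget m (g m)) (p.eval m)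
          (fun x : Fin m × Fin m → Bool =>
            decide (SimpleGraph.fromRel fun u v => x (u, v) = true).IsHamiltonian)) ↔
      ∃ p : Polynomial ℕ, ∀ m : ℕ,
        HasSymCircuit tcBasis (pointStabiliserBudget m (g m)) (p.eval m)
          (fun x : Fin m × Fin m → Bool =>
            decide (SimpleGraph.fromRel fun u v => x (u, v) = true).IsHamiltonian) := by
  constructor
  · rintro ⟨p, N, hN⟩
    let c : ℕ := ∑ m ∈ Finset.range N, (m * m + 2 ^ (m * m) + 1)
    refine ⟨p + Polynomial.C c, fun m => ?_⟩
    rw [Polynomial.eval_add, Polynomial.eval_C]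
    by_cases hm : N ≤ m
    · exact (hN m hm).mono (Nat.le_add_right _ _)
    · refine (hasSymCircuit_hamFn (m := m) _).mono ?_
      have hmem : m ∈ Finset.range N := Finset.mem_range.2 (Nat.not_le.1 hm)
      have : m * m + 2 ^ (m * m) + 1 ≤ c :=
        Finset.single_le_sum (f := fun m => m * m + 2 ^ (m * m) + 1) (fun _ _ => Nat.zero_le _) hmem
      omega
  · rintro ⟨p, hp⟩
    exact ⟨p, 0, fun m _ => hp m⟩

open scoped Classical in
/-- **`¬ WindowHam` in the "everywhere" form**: one polynomial `p` with a `Bud(m,⌊log₂ m⌋)`-symmetric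
threshold circuit of `≤ p m` gates for `HAM_m` at EVERY `m` — which is, verbatim, the CONCLUSION of the
sibling crux `HamCompiles`. -/
theorem not_windowHam_iff_forall :
    ¬ WindowHam ↔ ∃ p : Polynomial ℕ, ∀ m : ℕ,
      HasSymCircuit tcBasis (pointStabiliserBudget m (Nat.log 2 m)) (p.eval m)
        (fun x : Fin m × Fin m → Bool =>
          decide (SimpleGraph.fromRel fun u v => x (u, v) = true).IsHamiltonian) := by
  rw [← hasSym_ham_eventually_iff_forall]
  show (¬ ∀ p : Polynomial ℕ, ∃ᶠ m in atTop, ¬ HasSymCircuit tcBasis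
    (pointStabiliserBudget m (Nat.log 2 m)) (p.eval m) _) ↔ _
  push Not
  exact exists_congr fun p => Filter.eventually_atTop

/-- **`HamCompiles` unmasked**: the sibling crux is EXACTLY the implication
"NP ⊆ P (Cook's classes over `{0,1}`) ⟹ ¬ WindowHam". So a disproof of `WindowHam` is what
`HamCompiles` promises under P = NP, the route's `Assembly`/`closes` is the tautology
`W → (C → ¬W) → ¬C`, and refuting `WindowHam` unconditionally would prove `HamCompiles` outright
(`hamCompiles_iff_collapse_imp_not_windowHam.2 fun _ => h`; not stated as a theorem here because its
conclusion is a route item). -/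
theorem hamCompiles_iff_collapse_imp_not_windowHam :
    HamCompiles ↔
      (Literature.Computability.Complexity.PNPWave0.NP Bool ⊆
          Literature.Computability.Complexity.PNPWave0.P Bool → ¬ WindowHam) := by
  rw [not_windowHam_iff_forall]
  exact Iff.rfl

end Summit.PneNP.PneNP.Theorems.WindowHam.Negative
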